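import Summits.RiemannHypothesis.RiemannHypothesis.Theorems.TiltedLandingLaw421R3FlatMenuBBCert
import Summits.RiemannHypothesis.RiemannHypothesis.Theorems.TiltedLandingLaw421R3FlatMenuBBSound
import Summits.RiemannHypothesis.RiemannHypothesis.Theorems.TiltedLandingLaw421R3MenuThinTop

/-!
# «FlatMenuBBDoors» (W-08 C1, rh-idea-5 g42; module 4 of 4 of «FlatMenuBB»)

ASSEMBLY: chart 1 from the kernel certificate (module 2) and soundness (module 3); the tail `r ≥ 171` by hand (bottom region `Qr ≤ 3/2`,
C3's analytic region `Qr ≥ 17`, and `ahp_tail` on `3/2 ≤ Qr ≤ 17`) ⇒ `menuFlatPH_holds : MenuFlatPH`; then the BRIDGE to the tree names of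
#1323 «MenuThinTop» (four `ring` identities + strictness of door 2) ⇒ `flatDoors_92_1_925` = the flat trichotomy
`FlatDoors3Sig (9/2) 1 (9/25)` of C4's «MenuThinLeaf», unfolded.
Nothing here bears on the truth of RH; RH is not proved (this is a SUPPORT computation for the E5 leaf of the W-08 sink line, not the crux).
-/

namespace RhW08.FlatMenuBB
open RhW08.LimitMenu

/-! ## §5 PH on chart 1 -/

/-- ★★★ package PH on chart 1: for `0 ≤ Q ≤ 1`, `1 ≤ r ≤ 171`,
`0 ≤ asecF (9/2) 1 Q r ∨ (0 ≤ ahpX (9/2) 1 Q r ∧ 0 ≤ ahpF (9/2) 1 Q r 1) ∨ 0 ≤ thpF (9/25) Q r (μ r)`. -/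
theorem phReads_chart1 {Q r : ℝ} (hQ0 : 0 ≤ Q) (hQ1 : Q ≤ 1) (hr1 : 1 ≤ r) (hr : r ≤ 171) : PHReads Q r :=
  bb_sound 60 0 1 1 171 bb_chart1 Q r (by simpa using hQ0) (by simpa using hQ1) (by simpa using hr1)
    (by simpa using hr) hQ0 hQ1 hr1

/-! ## §6 The tail `r ≥ 171` by hand, and package PH on the whole chart -/

/-- C3's ANALYTIC REGION (= «LimitMenuRooms» v2 `asecF_nonneg_of_region`): `0 ≤ J0`, `4J0 ≤ κr`, `2(D0 − κ) ≤ κQr ⇒ 0 ≤ asecF`. -/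
theorem asecF_nonneg_of_region' (J0 D0 Q r : ℝ) (hQ0 : 0 ≤ Q) (hQ1 : Q ≤ 1) (hr : 1 ≤ r) (hJ0 : 0 ≤ J0)
    (hJ : 4 * J0 ≤ kap * r) (hD : 2 * (D0 - kap) ≤ kap * (Q * r)) : 0 ≤ asecF J0 D0 Q r := by
  have hr0 : (0:ℝ) ≤ r := by linarith
  have hk : (0:ℝ) < kap := by unfold kap; norm_num
  have hW := sq_le_limW Q r hQ0 hr0
  have hW0 : 0 ≤ limW Q r := (limW_pos Q r hQ0 hr0).le
  have hQW : 0 ≤ Q * limW Q r * r := by positivity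
  have h1 : J0 * limPhi Q r ≤ kap * Q * limW Q r * r ^ 2 / 2 := by
    unfold limPhi
    have : 2 * J0 * (1 - Q) ≤ kap * r / 2 := by nlinarith
    nlinarith [mul_le_mul_of_nonneg_left this hQW]
  have hI0 := limI_nonneg' Q r hr0
  have hIW : limI Q r ≤ r * limW Q r := by
    unfold limI
    have h2 : (r - 1) ^ 2 * (1 - Q) ^ 2 ≤ limW Q r := by
      have : (1 - Q) ^ 2 ≤ 1 := by nlinarith
      nlinarith [mul_le_mul (by nlinarith : (r - 1) ^ 2 ≤ r ^ 2) this (by positivity) (by positivity)]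
    nlinarith [mul_le_mul_of_nonneg_left h2 hr0]
  have h2 : (D0 - kap) * limI Q r ≤ kap * Q * limW Q r * r ^ 2 / 2 := by
    rcases le_or_gt (D0 - kap) 0 with hneg | hpos
    · have : (D0 - kap) * limI Q r ≤ 0 := mul_nonpos_of_nonpos_of_nonneg hneg hI0
      have : 0 ≤ kap * Q * limW Q r * r ^ 2 / 2 := by positivity
      linarith
    · have h3 : (D0 - kap) * limI Q r ≤ (D0 - kap) * (r * limW Q r) := mul_le_mul_of_nonneg_left hIW hpos.le
      have h4 : (D0 - kap) * (r * limW Q r) ≤ kap * (Q * r) / 2 * (r * limW Q r) :=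
        mul_le_mul_of_nonneg_right (by linarith) (by positivity)
      nlinarith
  have h3 : kap * Q * limW Q r * r ^ 2 ≤ kap * Q * limW Q r ^ 2 := by
    have : 0 ≤ kap * Q * limW Q r := by positivity
    nlinarith [mul_le_mul_of_nonneg_left hW this]
  unfold asecF limN
  nlinarith

/-- the univariate heart of the tail: `64c² ≥ (172/162)²·(1 + c)²·(α²c + 1)` on `3/2 ≤ c ≤ 17`, `α = 29276/29241`
(true with a factor ≈ 2.8 to spare). -/
theorem tail_univariate {c : ℝ} (hc1 : 3 / 2 ≤ c) (hc2 : c ≤ 17) :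
    (172 / 162 : ℝ) ^ 2 * (1 + c) ^ 2 * ((29276 / 29241) ^ 2 * c + 1) ≤ 64 * c ^ 2 := by
  nlinarith [mul_nonneg (mul_nonneg (sub_nonneg.2 hc1) (sub_nonneg.2 hc2)) (by linarith : (0:ℝ) ≤ c),
    mul_nonneg (sub_nonneg.2 hc1) (sub_nonneg.2 hc2), sq_nonneg (c - 8)]

/-- ★ THE TAIL LEMMA: for `r ≥ 171` and `3/2 ≤ Qr ≤ 17` the A-HALF-PLANE read holds (crude monotone bounds: `X ≥ c·r²(r − 9)`,
`E ≤ r(1 + c)²(r + 1)²`, `rN ≤ c(r² + 35)² + r⁴`, `(r + 1)/(r − 9) ≤ 172/162`, `r² + 35 ≤ α r²`, then `tail_univariate`). -/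
theorem ahp_tail {Q r : ℝ} (hQ0 : 0 ≤ Q) (hQ1 : Q ≤ 1) (hr : 171 ≤ r) (hc1 : 3 / 2 ≤ Q * r) (hc2 : Q * r ≤ 17) :
    0 ≤ ahpX (9 / 2) 1 Q r ∧ 0 ≤ ahpF (9 / 2) 1 Q r 1 := by
  have hr0 : (0:ℝ) < r := by linarith
  set c := Q * r with hc
  have hc0 : 0 ≤ c := by rw [hc]; positivity
  have hWdef : limW Q r = r ^ 2 + 1 + 2 * c := by unfold limW; rw [hc]; ring
  -- X lower bound
  have hX : c * r ^ 2 * (r - 9) ≤ ahpX (9 / 2) 1 Q r := by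
    rw [ahpX_PH_eq, hWdef]
    have h1 : Q * r ^ 2 ≤ Q * (r ^ 2 + 1 + 2 * c) := by nlinarith
    have h2 : r * (r - 9) ≤ r ^ 2 + 1 + 2 * c - 9 * (1 - Q) * r := by nlinarith
    have h3 : 0 ≤ r * (r - 9) := by nlinarith
    have := mul_le_mul h1 h2 h3 (by positivity)
    have h4 : Q * r ^ 2 * (r * (r - 9)) = c * r ^ 2 * (r - 9) := by rw [hc]; ring
    linarith [h4]
  have hXlo0 : 0 ≤ c * r ^ 2 * (r - 9) := mul_nonneg (mul_nonneg hc0 (by positivity)) (by linarith)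
  refine ⟨le_trans hXlo0 hX, ?_⟩
  -- E upper bound
  have hE : limE Q r ≤ r * (1 + c) ^ 2 * (r + 1) ^ 2 := by
    unfold limE
    have h1 : (Q + r) ^ 2 ≤ (r + 1) ^ 2 := by nlinarith
    have h2 : (1 + Q * r) ^ 2 = (1 + c) ^ 2 := by rw [hc]
    rw [h2]
    have : 0 ≤ r * (1 + c) ^ 2 := by positivity
    linarith [mul_le_mul_of_nonneg_left h1 this]
  -- r·N upper bound
  have hN : r * limN Q r ≤ c * (r ^ 2 + 35) ^ 2 + r ^ 4 := by
    unfold limN limI; rw [hWdef]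
    have h1 : (r ^ 2 + 1 + 2 * c) ^ 2 ≤ (r ^ 2 + 35) ^ 2 := by nlinarith
    have h2 : r * (Q * (r ^ 2 + 1 + 2 * c) ^ 2) = c * (r ^ 2 + 1 + 2 * c) ^ 2 := by rw [hc]; ring
    have h3 : (r - 1) ^ 2 * (1 - Q) ^ 2 ≤ r ^ 2 * 1 := by
      apply mul_le_mul (by nlinarith) (by nlinarith) (by positivity) (by positivity)
    have h4 : r * (r * (r - 1) ^ 2 * (1 - Q) ^ 2) ≤ r ^ 4 := by
      have := mul_le_mul_of_nonneg_left h3 (by positivity : (0:ℝ) ≤ r * r)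
      linarith
    linarith [mul_le_mul_of_nonneg_left h1 hc0]
  -- the two r-ratio bounds
  have hρ : (r + 1) ^ 2 ≤ (172 / 162) ^ 2 * (r - 9) ^ 2 := by
    have : (r + 1) ≤ 172 / 162 * (r - 9) := by linarith
    have h0 : 0 ≤ r + 1 := by linarith
    linarith [mul_le_mul this this h0 (by linarith)]
  have hα : (r ^ 2 + 35) ^ 2 ≤ (29276 / 29241 : ℝ) ^ 2 * (r ^ 2) ^ 2 := by
    have h29 : (29241 : ℝ) ≤ r ^ 2 := by
      have := mul_le_mul hr hr (by norm_num) (by linarith); nlinarith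
    have : r ^ 2 + 35 ≤ 29276 / 29241 * r ^ 2 := by linarith
    have h0 : 0 ≤ r ^ 2 + 35 := by positivity
    linarith [mul_le_mul this this h0 (by positivity)]
  -- combine: E·(rN) ≤ r(1+c)²(r+1)²·(c(r²+35)² + r⁴) ≤ r · 64c² r⁴ (r−9)²  ≤ 64 r X²
  have hU := tail_univariate hc1 hc2
  have hEN : limE Q r * (r * limN Q r) ≤ r * (1 + c) ^ 2 * (r + 1) ^ 2 * (c * (r ^ 2 + 35) ^ 2 + r ^ 4) := by
    have hN0 : 0 ≤ r * limN Q r := by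
      have : 0 ≤ limN Q r := by unfold limN; have := limI_nonneg' Q r hr0.le; positivity
      positivity
    exact mul_le_mul hE hN hN0 (by positivity)
  have hstep : (1 + c) ^ 2 * (r + 1) ^ 2 * (c * (r ^ 2 + 35) ^ 2 + r ^ 4) ≤ 64 * c ^ 2 * r ^ 4 * (r - 9) ^ 2 := by
    have h1 : c * (r ^ 2 + 35) ^ 2 + r ^ 4 ≤ ((29276 / 29241 : ℝ) ^ 2 * c + 1) * r ^ 4 := by
      linarith [mul_le_mul_of_nonneg_left hα hc0]
    have h2 : (1 + c) ^ 2 * (r + 1) ^ 2 ≤ (1 + c) ^ 2 * ((172 / 162) ^ 2 * (r - 9) ^ 2) :=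
      mul_le_mul_of_nonneg_left hρ (by positivity)
    have h3 := mul_le_mul h2 h1 (by positivity) (by positivity)
    have h4 : (1 + c) ^ 2 * ((172 / 162 : ℝ) ^ 2 * (r - 9) ^ 2) * (((29276 / 29241 : ℝ) ^ 2 * c + 1) * r ^ 4)
        = ((172 / 162 : ℝ) ^ 2 * (1 + c) ^ 2 * ((29276 / 29241) ^ 2 * c + 1)) * (r ^ 4 * (r - 9) ^ 2) := by ring
    rw [h4] at h3
    have h5 := mul_le_mul_of_nonneg_right hU (by positivity : (0:ℝ) ≤ r ^ 4 * (r - 9) ^ 2)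
    linarith
  have hXX : (c * r ^ 2 * (r - 9)) ^ 2 ≤ ahpX (9 / 2) 1 Q r ^ 2 := pow_le_pow_left₀ hXlo0 hX 2
  -- 64 r X² ≥ r·E·N, divide by r
  have hfin : r * (limE Q r * limN Q r) ≤ r * (64 * ahpX (9 / 2) 1 Q r ^ 2) := by
    have h1 : r * (limE Q r * limN Q r) = limE Q r * (r * limN Q r) := by ring
    have h2 : r * (1 + c) ^ 2 * (r + 1) ^ 2 * (c * (r ^ 2 + 35) ^ 2 + r ^ 4) ≤ r * (64 * (c * r ^ 2 * (r - 9)) ^ 2) := by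
      have := mul_le_mul_of_nonneg_left hstep hr0.le
      linarith
    have h3 := mul_le_mul_of_nonneg_left (mul_le_mul_of_nonneg_left hXX (by norm_num : (0:ℝ) ≤ 64)) hr0.le
    linarith
  have := le_of_mul_le_mul_left hfin hr0
  unfold ahpF; linarith

/-- ★★★ PACKAGE PH HOLDS on the whole chart `[0,1] × [1,∞)`: chart 1 by the kernel-checked B&B, the tail `r ≥ 171` by the bottom region
(`Qr ≤ 3/2`), the analytic region (`Qr ≥ 17`) and `ahp_tail`. -/
theorem menuFlatPH_holds : MenuFlatPH := by
  intro Q r hQ0 hQ1 hr1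
  rcases le_or_gt r 171 with hr | hr
  · exact phReads_chart1 hQ0 hQ1 hr1 hr
  -- tail
  have hk : kap = 27 / 256 := by unfold kap; norm_num
  rcases le_or_gt (Q * r) (3 / 2) with hc | hc
  · right; right
    apply thpF_nonneg_of_bottom' Q r hQ0 hQ1 hr1
    -- 8(1 + Qr) ≤ 20 ≤ 23.04(1 − Q) since Q ≤ 3/(2r) ≤ 3/342
    have hQsmall : Q * 342 ≤ 3 := by
      have := mul_le_mul_of_nonneg_left hr.le hQ0; linarith
    linarith
  rcases le_or_gt 17 (Q * r) with hc2 | hc2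
  · left
    apply asecF_nonneg_of_region' (9 / 2) 1 Q r hQ0 hQ1 hr1 (by norm_num)
    · rw [hk]; linarith
    · rw [hk]; linarith
  · right; left
    exact ahp_tail hQ0 hQ1 hr.le hc.le hc2.le


/-! ## §7 BRIDGE TO THE TREE NAMES OF #1323 «MenuThinTop» (C4): the flat trichotomy `FlatDoors3Sig (9/2) 1 (9/25)` of the E5 LEAF, unfolded -/

/-- door 1 dictionary: `asecF (9/2) 1 = limAjd (27/256) (9/2) 1` (#1323). -/
theorem asecF_eq_limAjd (Q r : ℝ) : asecF (9 / 2) 1 Q r = RhW08.MenuThinTop.limAjd (27 / 256) (9 / 2) 1 Q r := by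
  unfold asecF RhW08.MenuThinTop.limAjd limN limPhi limI kap; ring

/-- door 2 dictionary: `ahpX (9/2) 1 = limAjd 1 (9/2) 1`. -/
theorem ahpX_eq_limAjd (Q r : ℝ) : ahpX (9 / 2) 1 Q r = RhW08.MenuThinTop.limAjd 1 (9 / 2) 1 Q r := by
  unfold ahpX RhW08.MenuThinTop.limAjd limN limPhi limI; ring

/-- door 2 dictionary: `ahpF (9/2) 1 · · 1 = limHroom (9/2) 1`. -/
theorem ahpF_eq_limHroom (Q r : ℝ) : ahpF (9 / 2) 1 Q r 1 = RhW08.MenuThinTop.limHroom (9 / 2) 1 Q r := by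
  rw [ahpF, ahpX_eq_limAjd]; unfold RhW08.MenuThinTop.limHroom RhW08.MenuThinTop.limNk limE limN limI; ring

/-- door 4 dictionary: `thpF (9/25) · · (μ ·) = limTg (9/25)`. -/
theorem thpF_eq_limTg (Q r : ℝ) : thpF (9 / 25) Q r (limMu r) = RhW08.MenuThinTop.limTg (9 / 25) Q r := by
  unfold thpF limMu RhW08.MenuThinTop.limTg; ring

/-- strictness of door 2 off the corner: `0 ≤ X`, `0 ≤ 64X² − E·N` and `E·N > 0` (for `Q < 1 < r`) force `0 < X`. -/
theorem ahpX_pos_of_reads {Q r : ℝ} (hQ0 : 0 ≤ Q) (hQ1 : Q < 1) (hr : 1 < r)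
    (hX : 0 ≤ ahpX (9 / 2) 1 Q r) (hF : 0 ≤ ahpF (9 / 2) 1 Q r 1) : 0 < ahpX (9 / 2) 1 Q r := by
  rcases hX.lt_or_eq with h | h
  · exact h
  · exfalso
    have hE : 0 < limE Q r := by unfold limE; positivity
    have hI : 0 < limI Q r := by
      unfold limI
      have h1 : 0 < (r - 1) ^ 2 := by have : 0 < r - 1 := by linarith
                                      positivity
      have h2 : 0 < (1 - Q) ^ 2 := by have : 0 < 1 - Q := by linarith
                                      positivity
      have h0 : (0:ℝ) < r := by linarith
      positivity
    have hN : 0 < limN Q r := by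
      unfold limN; have : 0 ≤ Q * limW Q r ^ 2 := by positivity
      linarith
    have hEN := mul_pos hE hN
    unfold ahpF at hF; rw [← h] at hF
    nlinarith

/-- ★★★★ THE E5 FLAT TRICHOTOMY AT `(j, d, g) = (9/2, 1, 9/25)` OVER THE TREE NAMES OF #1323 — i.e. C4's `FlatDoors3Sig (9/2) 1 (9/25)`
(«MenuThinLeaf» IMAGECAND v1 :71, token 171) UNFOLDED: at every chart point `0 ≤ Q < 1 < r` one of door 1 `0 ≤ A_{27/256}`, door 2
`0 < A₁ ∧ 0 ≤ H`, door 4 `0 ≤ T_{9/25}` is open.  Proof = `menuFlatPH_holds` (kernel B&B + tail) + the four `ring` identities + strictness. -/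
theorem flatDoors_92_1_925 (Q r : ℝ) (hQ0 : 0 ≤ Q) (hQ1 : Q < 1) (hr : 1 < r) :
    0 ≤ RhW08.MenuThinTop.limAjd (27 / 256) (9 / 2) 1 Q r ∨
      (0 < RhW08.MenuThinTop.limAjd 1 (9 / 2) 1 Q r ∧ 0 ≤ RhW08.MenuThinTop.limHroom (9 / 2) 1 Q r) ∨
      0 ≤ RhW08.MenuThinTop.limTg (9 / 25) Q r := by
  rcases menuFlatPH_holds Q r hQ0 hQ1.le hr.le with h1 | ⟨hX, hF⟩ | h4
  · left; rwa [← asecF_eq_limAjd]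
  · right; left
    refine ⟨?_, ?_⟩
    · rw [← ahpX_eq_limAjd]; exact ahpX_pos_of_reads hQ0 hQ1 hr hX hF
    · rwa [← ahpF_eq_limHroom]
  · right; right; rwa [← thpF_eq_limTg]

end RhW08.FlatMenuBB
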